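import Summits.BirchSwinnertonDyer.BirchSwinnertonDyer.Theorems.ManinLocalTwoThreeNewformForty
import HarnessLib

/-!
# Level 72 (`2³·3²`, genus `g(X₀(72)) = 5`, in BOTH crux domains `4 ∣ 72`, `9 ∣ 72`), newform part 1: three `η`-quotient cusp forms
# supported on the divisors of `12`, and their first three `q`-coefficients — FACT-FREE

Cell bsd-f2-manin, route `ManinLocalTwoThree` (cruxes C2 `ManinOddAtFour` stmt-22967 and C3 `ManinPrimeToThreeAtNine` stmt-22968), prover seat
p2 gen 27.  `S₂(Γ₀(72)) = ℂf₂₄ ⊕ ℂf₂₄(3τ) ⊕ ℂf₃₆ ⊕ ℂf₃₆(2τ) ⊕ ℂφ₇₂` (`dim = g = 5`), newform `φ₇₂` = Cremona `72a1`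
(`aₙ = 1, 0, 0, 0, 2, 0, 0, 0, 0, 0, −4, …`).  THE DEVICE of the level-`40` files (`NewformForty*`), pushed one step: `φ₇₂` is not an
`η`-quotient, but the new subspace lies in `K = ker(Tr₇₂→₃₆) ∩ ker(Tr₇₂→₂₄)`, a `3`-dimensional space SPANNED BY `η`-QUOTIENT CUSP FORMS
SUPPORTED ON THE DIVISORS OF `12` (exhaustive Newman–Ligozat search, seat folder `scripts/search72.py`):

  `h₁ = η₄⁴η₆²/η₂² = q + 2q³ + q⁵ + ⋯`,  `h₂ = η₂⁴η₁₂²/η₄² = q − 4q³ + 4q⁵ − ⋯`,  `h₃ = η₁₂⁴ = f₃₆(2τ) = q² − 4q¹⁴ + ⋯`,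

and `φ₇₂ = ⅔h₁ + ⅓h₂`.  Support on the divisors of `12 = gcd`-friendly part of `24` and `36` makes Dedekind's functional equation under
`(1 0; 24 1)`, `(1 0; 48 1)` AND `(1 0; 36 1)` apply factor by factor (sequel `…NewformSeventyTwoTrace`).

* §1 `h₁, h₂, h₃ ∈ S₂(Γ₀(72))` (Ligozat certificates at the `12` cusps of `Γ₀(72)`).
* §2 `q`-asymptotics: `h₁ = q + 2q³ + o(q³)`, `h₂ = q − 4q³ + o(q³)`, `h₃ = q² + o(q³)`; a general three-coefficient extraction lemma
  `cuspCoeff_eq_of_tendsto_cube` (extends `NewformForty.cuspCoeff_eq_of_tendsto_sq`); `(a₁, a₂, a₃)(h₁) = (1, 0, 2)`,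
  `(h₂) = (1, 0, −4)`, `(h₃) = (0, 1, 0)` — the matrix that the sequel `…NewformPinningSeventyTwo` inverts against `a₁(D.f) = 1`,
  `a₂(D.f) = 0` (`4 ∣ 72`), `a₃(D.f) = 0` (`9 ∣ 72`).

No definition, no named fact, no sorry.  Nothing here proves C2, C3, Manin's conjecture or BSD. [cite: Ligozat1975, Ch. 3]
[cite: DiamondShurman2005, §1.1, §5.6] [cite: CremonaAlgorithms1997, Table 3 (N = 72)]
-/

set_option autoImplicit false
-- lint-debt: the directory name repeats the summit name (sibling precedent `ManinLocalTwoThreeNewformForty.lean`)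
set_option linter.dupNamespace false

noncomputable section

open Complex Filter Topology Set Function Asymptotics Polynomial
open UpperHalfPlane hiding I
open scoped Real Topology Manifold MatrixGroups ModularForm
open ModularForm CongruenceSubgroup Matrix.SpecialLinearGroup
open Literature.NumberTheory.ModularForms
open Literature.NumberTheory.EllipticCurves Literature.NumberTheory.EllipticCurves.ModularForms

namespace Summit.BirchSwinnertonDyer.BirchSwinnertonDyer.Theorems.ManinLocalTwoThree.NewformSeventyTwo

open CuspToolkit QRemainder EulerRemainders NewformForty

/-! ## §1 `h₁ = η₄⁴η₆²/η₂²`, `h₂ = η₂⁴η₁₂²/η₄²`, `h₃ = η₁₂⁴` are cusp forms on `Γ₀(72)` -/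

/-- Ligozat/Newman certificate of `h₁ = η₄⁴η₆²/η₂²` at level `72` (`∏δ^{|r|} = 192²`). [cite: Ligozat1975, Ch. 3] -/
theorem etaCert_h1 : EtaCert 72 [(2, -2), (4, 4), (6, 2)] 192 := by
  decide

/-- Ligozat/Newman certificate of `h₂ = η₂⁴η₁₂²/η₄²` at level `72` (`∏δ^{|r|} = 192²`). [cite: Ligozat1975, Ch. 3] -/
theorem etaCert_h2 : EtaCert 72 [(2, 4), (4, -2), (12, 2)] 192 := by
  decide

/-- Ligozat/Newman certificate of `h₃ = η₁₂⁴` at level `72` (`∏δ^{|r|} = 144²`). [cite: Ligozat1975, Ch. 3] -/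
theorem etaCert_h3 : EtaCert 72 [(12, 4)] 144 := by
  decide

/-- **`h₁ ∈ S₂(Γ₀(72))`.** [cite: Ligozat1975, Ch. 3] -/
theorem exists_cuspForm_h1 : ∃ H : CuspForm (Gamma0 72) 2, ⇑H = etaQuotient 72 (expFn [(2, -2), (4, 4), (6, 2)]) :=
  ⟨etaQuotientCuspForm 72 _ 2 (by decide) (newmanCond_of_etaCert etaCert_h1) etaCert_h1.2.2.2.2, rfl⟩

/-- **`h₂ ∈ S₂(Γ₀(72))`.** [cite: Ligozat1975, Ch. 3] -/
theorem exists_cuspForm_h2 : ∃ H : CuspForm (Gamma0 72) 2, ⇑H = etaQuotient 72 (expFn [(2, 4), (4, -2), (12, 2)]) :=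
  ⟨etaQuotientCuspForm 72 _ 2 (by decide) (newmanCond_of_etaCert etaCert_h2) etaCert_h2.2.2.2.2, rfl⟩

/-- **`h₃ ∈ S₂(Γ₀(72))`.** [cite: Ligozat1975, Ch. 3] -/
theorem exists_cuspForm_h3 : ∃ H : CuspForm (Gamma0 72) 2, ⇑H = etaQuotient 72 (expFn [(12, 4)]) :=
  ⟨etaQuotientCuspForm 72 _ 2 (by decide) (newmanCond_of_etaCert etaCert_h3) etaCert_h3.2.2.2.2, rfl⟩

/-! ## §2 `q`-asymptotics and the first three coefficients -/

/-- **An `η`-quotient of level `72` supported on the divisors of `12` is the same product at level `12`.** [folklore] -/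
theorem etaQuotient72_eq_12 (L : List (ℕ × ℤ)) (h : ∀ t ∈ Nat.divisors 72, t ∉ Nat.divisors 12 → expFn L t = 0) (τ : ℍ) :
    etaQuotient 72 (expFn L) τ = etaQuotient 12 (expFn L) τ := by
  rw [etaQuotient_apply, etaQuotient_apply]
  symm
  refine Finset.prod_subset (Nat.divisors_subset_of_dvd (by norm_num) (by norm_num)) fun t ht hnt ↦ ?_
  rw [h t ht hnt, zpow_zero]

/-- **`h₁ = η₄⁴η₆²/η₂² = qE₄⁴E₆²/E₂²`.** [folklore] -/
theorem h1_eq (τ : ℍ) :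
    etaQuotient 72 (expFn [(2, -2), (4, 4), (6, 2)]) τ
      = Function.Periodic.qParam 1 (τ : ℂ) * eulerFn 4 τ ^ 4 * eulerFn 6 τ ^ 2 / eulerFn 2 τ ^ 2 := by
  have hE2 := eulerFn_ne_zero (by norm_num : 0 < 2) τ
  rw [etaQuotient72_eq_12 _ (by decide), etaQuotient_eq_cexp_mul_prod, show Nat.divisors 12 = {1, 2, 3, 4, 6, 12} by decide]
  have hsum : (∑ δ ∈ ({1, 2, 3, 4, 6, 12} : Finset ℕ), (δ : ℤ) * expFn [(2, -2), (4, 4), (6, 2)] δ) = ((24 * 1 : ℕ) : ℤ) := by decide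
  rw [hsum, EulerRemaindersSixtyFour.cexp_eq_qParam_pow, pow_one]
  rw [Finset.prod_insert (by decide), Finset.prod_insert (by decide), Finset.prod_insert (by decide),
    Finset.prod_insert (by decide), Finset.prod_insert (by decide), Finset.prod_singleton]
  rw [show expFn [(2, -2), (4, 4), (6, 2)] 1 = 0 by decide, show expFn [(2, -2), (4, 4), (6, 2)] 2 = (-2) by decide,
    show expFn [(2, -2), (4, 4), (6, 2)] 3 = 0 by decide, show expFn [(2, -2), (4, 4), (6, 2)] 4 = 4 by decide,
    show expFn [(2, -2), (4, 4), (6, 2)] 6 = 2 by decide, show expFn [(2, -2), (4, 4), (6, 2)] 12 = 0 by decide]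
  simp only [zpow_neg, zpow_ofNat]
  field_simp

/-- **`h₂ = η₂⁴η₁₂²/η₄² = qE₂⁴E₁₂²/E₄²`.** [folklore] -/
theorem h2_eq (τ : ℍ) :
    etaQuotient 72 (expFn [(2, 4), (4, -2), (12, 2)]) τ
      = Function.Periodic.qParam 1 (τ : ℂ) * eulerFn 2 τ ^ 4 * eulerFn 12 τ ^ 2 / eulerFn 4 τ ^ 2 := by
  have hE4 := eulerFn_ne_zero (by norm_num : 0 < 4) τ
  rw [etaQuotient72_eq_12 _ (by decide), etaQuotient_eq_cexp_mul_prod, show Nat.divisors 12 = {1, 2, 3, 4, 6, 12} by decide]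
  have hsum : (∑ δ ∈ ({1, 2, 3, 4, 6, 12} : Finset ℕ), (δ : ℤ) * expFn [(2, 4), (4, -2), (12, 2)] δ) = ((24 * 1 : ℕ) : ℤ) := by decide
  rw [hsum, EulerRemaindersSixtyFour.cexp_eq_qParam_pow, pow_one]
  rw [Finset.prod_insert (by decide), Finset.prod_insert (by decide), Finset.prod_insert (by decide),
    Finset.prod_insert (by decide), Finset.prod_insert (by decide), Finset.prod_singleton]
  rw [show expFn [(2, 4), (4, -2), (12, 2)] 1 = 0 by decide, show expFn [(2, 4), (4, -2), (12, 2)] 2 = 4 by decide,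
    show expFn [(2, 4), (4, -2), (12, 2)] 3 = 0 by decide, show expFn [(2, 4), (4, -2), (12, 2)] 4 = (-2) by decide,
    show expFn [(2, 4), (4, -2), (12, 2)] 6 = 0 by decide, show expFn [(2, 4), (4, -2), (12, 2)] 12 = 2 by decide]
  simp only [zpow_neg, zpow_ofNat]
  field_simp

/-- **`h₃ = η₁₂⁴ = q²E₁₂⁴`.** [folklore] -/
theorem h3_eq (τ : ℍ) :
    etaQuotient 72 (expFn [(12, 4)]) τ = Function.Periodic.qParam 1 (τ : ℂ) ^ 2 * eulerFn 12 τ ^ 4 := by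
  rw [etaQuotient72_eq_12 _ (by decide), etaQuotient_eq_cexp_mul_prod, show Nat.divisors 12 = {1, 2, 3, 4, 6, 12} by decide]
  have hsum : (∑ δ ∈ ({1, 2, 3, 4, 6, 12} : Finset ℕ), (δ : ℤ) * expFn [(12, 4)] δ) = ((24 * 2 : ℕ) : ℤ) := by decide
  rw [hsum, EulerRemaindersSixtyFour.cexp_eq_qParam_pow]
  rw [Finset.prod_insert (by decide), Finset.prod_insert (by decide), Finset.prod_insert (by decide),
    Finset.prod_insert (by decide), Finset.prod_insert (by decide), Finset.prod_singleton]
  rw [show expFn [(12, 4)] 1 = 0 by decide, show expFn [(12, 4)] 2 = 0 by decide, show expFn [(12, 4)] 3 = 0 by decide,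
    show expFn [(12, 4)] 4 = 0 by decide, show expFn [(12, 4)] 6 = 0 by decide, show expFn [(12, 4)] 12 = 4 by decide]
  simp only [zpow_ofNat]
  ring

/-- **Coefficient extraction from a three-term expansion**: if `S ∈ S₂(Γ₀(N))` satisfies `S = aq + bq² + cq³ + o(q³)` at `i∞`, then
`a₁(S) = a`, `a₂(S) = b`, `a₃(S) = c`. [cite: DiamondShurman2005, §1.1] -/
theorem cuspCoeff_eq_of_tendsto_cube {N : ℕ} (S : CuspForm (Gamma0 N) 2) {a b c : ℂ}
    (h : Tendsto (fun τ : ℍ ↦ (S τ - (C a * X + C b * X ^ 2 + C c * X ^ 3 : ℂ[X]).eval (Function.Periodic.qParam 1 (τ : ℂ)))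
      / Function.Periodic.qParam 1 (τ : ℂ) ^ 3) atImInfty (𝓝 0)) :
    cuspCoeff S 1 = a ∧ cuspCoeff S 2 = b ∧ cuspCoeff S 3 = c := by
  have hΓ := one_mem_strictPeriods_coe_gamma0 N
  have hper : Function.Periodic (⇑S ∘ ofComplex) 1 := SlashInvariantFormClass.periodic_comp_ofComplex S hΓ
  have hmd : MDifferentiable 𝓘(ℂ) 𝓘(ℂ) ⇑S := CuspFormClass.holo S
  haveI : Fact (IsCusp OnePoint.infty ((Gamma0 N : Subgroup SL(2, ℤ)) : Subgroup (GL (Fin 2) ℝ))) :=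
    ⟨Subgroup.isCusp_of_mem_strictPeriods one_pos hΓ⟩
  have hbd : IsBoundedAtImInfty ⇑S := ModularFormClass.bdd_at_infty S
  have hsum : ∀ τ : ℍ, HasSum (fun n : ℕ ↦ cuspCoeff S n • Function.Periodic.qParam 1 (τ : ℂ) ^ n) (S τ) :=
    fun τ ↦ hasSum_qExpansion one_pos hper hmd hbd τ
  have h3 := tendsto_of_hasSum hper hmd hbd hsum 3
  have hD := h.sub h3
  rw [sub_zero] at hD
  -- `E(τ) := c₀ + (c₁ − a)q + (c₂ − b)q² + (c₃ − c)q³` satisfies `E/q³ → 0`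
  have hD' : Tendsto (fun τ : ℍ ↦ (cuspCoeff S 0 + (cuspCoeff S 1 - a) * Function.Periodic.qParam 1 (τ : ℂ)
      + (cuspCoeff S 2 - b) * Function.Periodic.qParam 1 (τ : ℂ) ^ 2 + (cuspCoeff S 3 - c) * Function.Periodic.qParam 1 (τ : ℂ) ^ 3)
      / Function.Periodic.qParam 1 (τ : ℂ) ^ 3) atImInfty (𝓝 0) := by
    refine hD.congr fun τ ↦ ?_
    simp only [Finset.sum_range_succ, Finset.sum_range_zero, eval_add, eval_mul, eval_C, eval_pow, eval_X, zero_add]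
    ring
  have hq := QRemainder.tendsto_qParam
  -- (i) `c₀ = 0`
  have h0 : cuspCoeff S 0 = 0 := by
    have hA := hD'.mul (hq.pow 3)
    rw [zero_mul] at hA
    have hB : Tendsto (fun τ : ℍ ↦ cuspCoeff S 0 + (cuspCoeff S 1 - a) * Function.Periodic.qParam 1 (τ : ℂ)
        + (cuspCoeff S 2 - b) * Function.Periodic.qParam 1 (τ : ℂ) ^ 2 + (cuspCoeff S 3 - c) * Function.Periodic.qParam 1 (τ : ℂ) ^ 3)
        atImInfty (𝓝 (cuspCoeff S 0)) := by
      have := (((tendsto_const_nhds (x := cuspCoeff S 0)).add (hq.const_mul (cuspCoeff S 1 - a))).add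
        ((hq.pow 2).const_mul (cuspCoeff S 2 - b))).add ((hq.pow 3).const_mul (cuspCoeff S 3 - c))
      rw [mul_zero, add_zero, zero_pow two_ne_zero, mul_zero, add_zero, zero_pow three_ne_zero, mul_zero, add_zero] at this
      exact this
    have hA' : Tendsto (fun τ : ℍ ↦ cuspCoeff S 0 + (cuspCoeff S 1 - a) * Function.Periodic.qParam 1 (τ : ℂ)
        + (cuspCoeff S 2 - b) * Function.Periodic.qParam 1 (τ : ℂ) ^ 2 + (cuspCoeff S 3 - c) * Function.Periodic.qParam 1 (τ : ℂ) ^ 3)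
        atImInfty (𝓝 0) := by
      refine hA.congr fun τ ↦ ?_
      exact div_mul_cancel₀ _ (pow_ne_zero _ (qParam_ne_zero τ))
    exact tendsto_nhds_unique hB hA'
  -- (ii) `c₁ = a`
  have h1 : cuspCoeff S 1 = a := by
    have hA := hD'.mul (hq.pow 2)
    rw [zero_mul] at hA
    have hA' : Tendsto (fun τ : ℍ ↦ (cuspCoeff S 1 - a) + (cuspCoeff S 2 - b) * Function.Periodic.qParam 1 (τ : ℂ)
        + (cuspCoeff S 3 - c) * Function.Periodic.qParam 1 (τ : ℂ) ^ 2) atImInfty (𝓝 0) := by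
      refine hA.congr fun τ ↦ ?_
      have hqτ := qParam_ne_zero τ
      rw [h0]
      field_simp
      ring
    have hB : Tendsto (fun τ : ℍ ↦ (cuspCoeff S 1 - a) + (cuspCoeff S 2 - b) * Function.Periodic.qParam 1 (τ : ℂ)
        + (cuspCoeff S 3 - c) * Function.Periodic.qParam 1 (τ : ℂ) ^ 2) atImInfty (𝓝 (cuspCoeff S 1 - a)) := by
      have := ((tendsto_const_nhds (x := cuspCoeff S 1 - a)).add (hq.const_mul (cuspCoeff S 2 - b))).add
        ((hq.pow 2).const_mul (cuspCoeff S 3 - c))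
      rw [mul_zero, add_zero, zero_pow two_ne_zero, mul_zero, add_zero] at this
      exact this
    exact sub_eq_zero.mp (tendsto_nhds_unique hB hA')
  -- (iii) `c₂ = b`
  have h2 : cuspCoeff S 2 = b := by
    have hA := hD'.mul hq
    rw [zero_mul] at hA
    have hA' : Tendsto (fun τ : ℍ ↦ (cuspCoeff S 2 - b) + (cuspCoeff S 3 - c) * Function.Periodic.qParam 1 (τ : ℂ))
        atImInfty (𝓝 0) := by
      refine hA.congr fun τ ↦ ?_
      have hqτ := qParam_ne_zero τ
      rw [h0, h1]
      field_simp
      ring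
    have hB : Tendsto (fun τ : ℍ ↦ (cuspCoeff S 2 - b) + (cuspCoeff S 3 - c) * Function.Periodic.qParam 1 (τ : ℂ))
        atImInfty (𝓝 (cuspCoeff S 2 - b)) := by
      have := (tendsto_const_nhds (x := cuspCoeff S 2 - b)).add (hq.const_mul (cuspCoeff S 3 - c))
      rw [mul_zero, add_zero] at this
      exact this
    exact sub_eq_zero.mp (tendsto_nhds_unique hB hA')
  -- (iv) `c₃ = c`
  have h3' : cuspCoeff S 3 = c := by
    have hA' : Tendsto (fun _ : ℍ ↦ cuspCoeff S 3 - c) atImInfty (𝓝 0) := by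
      refine hD'.congr fun τ ↦ ?_
      have hqτ := qParam_ne_zero τ
      rw [h0, h1, h2]
      field_simp
      ring
    exact sub_eq_zero.mp (tendsto_nhds_unique tendsto_const_nhds hA')
  exact ⟨h1, h2, h3'⟩

/-- **`h₁ = q + 0·q² + 2q³ + o(q³)`** (`E₂² = 1 − 2q² + o(q³)` with inverse `1 + 2q²`, `E₄ = E₆ = 1 + o(q³)`). [folklore] -/
theorem tendsto_h1_sub :
    Tendsto (fun τ : ℍ ↦ (etaQuotient 72 (expFn [(2, -2), (4, 4), (6, 2)]) τ
      - (C 1 * X + C 0 * X ^ 2 + C 2 * X ^ 3 : ℂ[X]).eval (Function.Periodic.qParam 1 (τ : ℂ)))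
      / Function.Periodic.qParam 1 (τ : ℂ) ^ 3) atImInfty (𝓝 0) := by
  have hE2 := EulerRemaindersTwenty.tendsto_mono (show 3 ≤ 9 by norm_num) EulerRemaindersFortyEight.tendsto_eulerFn_two_nine
  have hE4 := tendsto_eulerFn (δ := 4) (m := 3) (by norm_num)
  have hE6 := tendsto_eulerFn (δ := 6) (m := 3) (by norm_num)
  have hden := QRemainder.reduce (1 - 2 * X ^ 2) (-1 + 2 * X ^ 2 + X ^ 4) (by ring) (QRemainder.pow hE2 2)
  have hinv := QRemainder.inv (1 + 2 * X ^ 2) (-4 : ℂ[X]) (by ring)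
    (fun τ ↦ pow_ne_zero _ (eulerFn_ne_zero (by norm_num) τ)) (by simp) hden
  have hG := QRemainder.congr_poly (P' := C 1 * X + C 0 * X ^ 2 + C 2 * X ^ 3) (by simp only [map_one, map_zero, map_ofNat]; ring)
    (QRemainder.reduce (X + 2 * X ^ 3) (0 : ℂ[X]) (by ring)
      (QRemainder.qParam_pow_mul 1 (QRemainder.mul (QRemainder.mul (QRemainder.pow hE4 4) (QRemainder.pow hE6 2)) hinv)))
  refine hG.congr fun τ ↦ ?_
  rw [h1_eq]
  ring

/-- **`h₂ = q + 0·q² − 4q³ + o(q³)`** (`E₂⁴ = 1 − 4q² + o(q³)`, `E₄ = E₁₂ = 1 + o(q³)`). [folklore] -/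
theorem tendsto_h2_sub :
    Tendsto (fun τ : ℍ ↦ (etaQuotient 72 (expFn [(2, 4), (4, -2), (12, 2)]) τ
      - (C 1 * X + C 0 * X ^ 2 + C (-4) * X ^ 3 : ℂ[X]).eval (Function.Periodic.qParam 1 (τ : ℂ)))
      / Function.Periodic.qParam 1 (τ : ℂ) ^ 3) atImInfty (𝓝 0) := by
  have hE2 := EulerRemaindersTwenty.tendsto_mono (show 3 ≤ 9 by norm_num) EulerRemaindersFortyEight.tendsto_eulerFn_two_nine
  have hE4 := tendsto_eulerFn (δ := 4) (m := 3) (by norm_num)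
  have hE12 := tendsto_eulerFn (δ := 12) (m := 3) (by norm_num)
  have hinv := QRemainder.inv (1 : ℂ[X]) (0 : ℂ[X]) (by ring)
    (fun τ ↦ pow_ne_zero _ (eulerFn_ne_zero (by norm_num) τ)) (by simp) (QRemainder.pow hE4 2)
  have hG := QRemainder.congr_poly (P' := C 1 * X + C 0 * X ^ 2 + C (-4) * X ^ 3) (by simp only [map_one, map_zero, map_neg, map_ofNat]; ring)
    (QRemainder.reduce (X - 4 * X ^ 3)
      (2 * X + 8 * X ^ 3 - 5 * X ^ 5 - 8 * X ^ 7 + 2 * X ^ 9 + 4 * X ^ 11 + X ^ 13 : ℂ[X]) (by ring)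
      (QRemainder.qParam_pow_mul 1 (QRemainder.mul (QRemainder.mul (QRemainder.pow hE2 4) (QRemainder.pow hE12 2)) hinv)))
  refine hG.congr fun τ ↦ ?_
  rw [h2_eq]
  ring

/-- **`h₃ = 0·q + q² + 0·q³ + o(q³)`.** [folklore] -/
theorem tendsto_h3_sub :
    Tendsto (fun τ : ℍ ↦ (etaQuotient 72 (expFn [(12, 4)]) τ
      - (C 0 * X + C 1 * X ^ 2 + C 0 * X ^ 3 : ℂ[X]).eval (Function.Periodic.qParam 1 (τ : ℂ)))
      / Function.Periodic.qParam 1 (τ : ℂ) ^ 3) atImInfty (𝓝 0) := by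
  have hE12 := tendsto_eulerFn (δ := 12) (m := 3) (by norm_num)
  have hG := QRemainder.congr_poly (P' := C 0 * X + C 1 * X ^ 2 + C 0 * X ^ 3) (by simp only [map_one, map_zero]; ring)
    (QRemainder.qParam_pow_mul 2 (QRemainder.pow hE12 4))
  refine hG.congr fun τ ↦ ?_
  rw [h3_eq]

/-- **`(a₁, a₂, a₃)(h₁) = (1, 0, 2)`.** [folklore] -/
theorem cuspCoeff_h1 (H : CuspForm (Gamma0 72) 2) (hH : ⇑H = etaQuotient 72 (expFn [(2, -2), (4, 4), (6, 2)])) :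
    cuspCoeff H 1 = 1 ∧ cuspCoeff H 2 = 0 ∧ cuspCoeff H 3 = 2 :=
  cuspCoeff_eq_of_tendsto_cube H (by simpa only [hH] using tendsto_h1_sub)

/-- **`(a₁, a₂, a₃)(h₂) = (1, 0, −4)`.** [folklore] -/
theorem cuspCoeff_h2 (H : CuspForm (Gamma0 72) 2) (hH : ⇑H = etaQuotient 72 (expFn [(2, 4), (4, -2), (12, 2)])) :
    cuspCoeff H 1 = 1 ∧ cuspCoeff H 2 = 0 ∧ cuspCoeff H 3 = -4 :=
  cuspCoeff_eq_of_tendsto_cube H (by simpa only [hH] using tendsto_h2_sub)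

/-- **`(a₁, a₂, a₃)(h₃) = (0, 1, 0)`.** [folklore] -/
theorem cuspCoeff_h3 (H : CuspForm (Gamma0 72) 2) (hH : ⇑H = etaQuotient 72 (expFn [(12, 4)])) :
    cuspCoeff H 1 = 0 ∧ cuspCoeff H 2 = 1 ∧ cuspCoeff H 3 = 0 :=
  cuspCoeff_eq_of_tendsto_cube H (by simpa only [hH] using tendsto_h3_sub)

/-- `h₁/q → 1`, `h₂/q → 1`, `h₃/q² → 1` at `i∞` (orders `1, 1, 2`). [folklore] -/
theorem tendsto_h_div_qParam :
    Tendsto (fun τ : ℍ ↦ etaQuotient 72 (expFn [(2, -2), (4, 4), (6, 2)]) τ / Function.Periodic.qParam 1 (τ : ℂ) ^ (1 : ℤ)) atImInfty (𝓝 1)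
    ∧ Tendsto (fun τ : ℍ ↦ etaQuotient 72 (expFn [(2, 4), (4, -2), (12, 2)]) τ / Function.Periodic.qParam 1 (τ : ℂ) ^ (1 : ℤ)) atImInfty (𝓝 1)
    ∧ Tendsto (fun τ : ℍ ↦ etaQuotient 72 (expFn [(12, 4)]) τ / Function.Periodic.qParam 1 (τ : ℂ) ^ (2 : ℤ)) atImInfty (𝓝 1) :=
  ⟨tendsto_etaQuotient_div_qParam_zpow 72 _ 1 (by decide), tendsto_etaQuotient_div_qParam_zpow 72 _ 1 (by decide),
    tendsto_etaQuotient_div_qParam_zpow 72 _ 2 (by decide)⟩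

/-- **`(h₁ − h₂)/q³ → 6`** at `i∞` (the combination of order `3`, for linear independence). [folklore] -/
theorem tendsto_h1_sub_h2_div :
    Tendsto (fun τ : ℍ ↦ (etaQuotient 72 (expFn [(2, -2), (4, 4), (6, 2)]) τ - etaQuotient 72 (expFn [(2, 4), (4, -2), (12, 2)]) τ)
      / Function.Periodic.qParam 1 (τ : ℂ) ^ (3 : ℤ)) atImInfty (𝓝 6) := by
  have h := QRemainder.sub tendsto_h1_sub tendsto_h2_sub
  have h6 : Tendsto (fun τ : ℍ ↦ (etaQuotient 72 (expFn [(2, -2), (4, 4), (6, 2)]) τ - etaQuotient 72 (expFn [(2, 4), (4, -2), (12, 2)]) τ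
      - ((C 1 * X + C 0 * X ^ 2 + C 2 * X ^ 3) - (C 1 * X + C 0 * X ^ 2 + C (-4) * X ^ 3) : ℂ[X]).eval (Function.Periodic.qParam 1 (τ : ℂ)))
      / Function.Periodic.qParam 1 (τ : ℂ) ^ 3 + 6) atImInfty (𝓝 6) := by
    simpa using h.add_const 6
  refine h6.congr fun τ ↦ ?_
  have hqτ := qParam_ne_zero τ
  simp only [eval_sub, eval_add, eval_mul, eval_C, eval_pow, eval_X, zpow_ofNat]
  field_simp
  ring

end Summit.BirchSwinnertonDyer.BirchSwinnertonDyer.Theorems.ManinLocalTwoThree.NewformSeventyTwo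

end
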